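import Literature.NumberTheory.LFunctions.BombieriLagariasZeroLocation
import Literature.NumberTheory.LFunctions.WeilCriterionConverseDirichlet
import Literature.NumberTheory.LFunctions.CharZeroSum
import Literature.NumberTheory.LFunctions.GeneralizedRH
import HarnessLib

/-!
# Li's criterion for a Dirichlet `L`-function: `GRH(χ) ⟺ Re λ_χ(n) ≥ 0` for all `n ≥ 1`, PROVED

Topic `Literature/NumberTheory/LFunctions`, sub-namespace `LiDirichlet`.  Everything in this file is
PROVED (no named facts); the two `def`s are Li's coefficient as printed and its real part.

X.-J. Li, *Explicit formulas for Dirichlet and Hecke `L`-functions*, Illinois J. Math. **48** (2004),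
491–503.  Setting (p. 493): "Let `χ` be a primitive Dirichlet character of modulus `r > 1` …
`ξ(s, χ) = (π/r)^{−(s+a)/2} Γ((s+a)/2) L(s, χ)` … is an entire function of order one and satisfies
the functional equation `ξ(s, χ) = ε_χ ξ(1 − s, χ̄)`."  Definition (p. 494): "For `n = 1, 2, …` let
`λ_χ(n) = Σ_ρ [1 − (1 − 1/ρ)ⁿ]`, where the sum on `ρ` runs over all zeros of `ξ(s, χ)` in the order
given by `|Im ρ| < T` for `T → ∞`."  Li's Theorem 2 (= Bombieri–Lagarias 1999, Theorem 1; in the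
tree as `bombieriLagarias1999_theorem1`, PROVED) is the criterion he applies to this multiset of
zeros (as he spells out for `ξ_E` on p. 496: "the conditions of Bombieri–Lagarias' theorem are
satisfied, and hence all the zeros of `ξ_E(s)` lie on the line `Re s = 1/2` if and only if
`λ_E(n) > 0` …"), and p. 493: "the positivity in the author's criterion has the same meaning as
that in Weil's criterion".

## What is typed, and the one point where the printed wording needs care

* The zeros of `ξ(s, χ)` are the non-trivial zeros of `L(s, χ)` (`0 < Re ρ < 1`, MV Cor. 10.8), in
  the tree `ExplicitPsiChar.charNontrivialZeros χ` with multiplicity `DirichletDisc.zeroOrder χ ρ`;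
  the truncations `|Im ρ| ≤ T` are `lfunctionZeroBox χ T` (`≤ T` and Li's `< T` have the same limit).
* `LiDirichlet.liCoeffChar χ n` — Li's `λ_χ(n)` AS PRINTED: the symmetric limit (`limUnder`) of the
  complex partial sums `Σ_{|Im ρ| ≤ T} m(ρ) [1 − (1 − 1/ρ)ⁿ]`.  Its EXISTENCE is Li's Theorem 4 (an
  explicit-formula evaluation, p. 494 / §2), not proved here and not needed for the criterion.
* For a complex character `λ_χ(n)` is NOT real: the zero multiset is stable under `ρ ↦ 1 − ρ̄`
  (functional equation + reflection, `WeilConverseChar.one_sub_conj_mem`), not under conjugation,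
  and Li's own Theorem 4 carries `χ̄(k)`.  Bombieri–Lagarias' condition (2) is printed with a real
  part, `Σ_ρ Re[1 − (1 − 1/ρ)^{−n}] ≥ 0`, and THAT sum converges absolutely; so the criterion typed
  here is on `LiDirichlet.liCoeffCharRe χ n := Σ' ρ m(ρ) · Re[1 − (1 − 1/ρ)ⁿ]` (absolutely convergent,
  `summable_liTermRe`), which is the limit of the real parts of Li's partial sums UNCONDITIONALLY
  (`tendsto_re_liPartialSum`) and equals `Re λ_χ(n)` whenever Li's limit exists
  (`re_eq_liCoeffCharRe_of_tendsto`).  The exponent `+n` (Li) versus `−n` (Bombieri–Lagarias) is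
  immaterial after `Re` on a `ρ ↦ 1 − ρ̄`-symmetric multiset (`bombieriLagarias1999_theorem1_pos`).

## Main results

* `LiDirichlet.riemannHypothesis_iff_liCoeffCharRe_nonneg` — for `χ` primitive mod `q > 1`:
  `χ.RiemannHypothesis ↔ ∀ n ≥ 1, 0 ≤ liCoeffCharRe χ n`.  Proof: Bombieri–Lagarias for the family
  of non-trivial zeros (weights `≤ 2 m(ρ)/(1 + γ²)`, summable by `summable_zeroOrder_div_one_add_sq`,
  MV Thm. 10.17) gives `Re ρ ≥ 1/2` for all zeros; the symmetry `ρ ↦ 1 − ρ̄` upgrades it to `= 1/2`.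
* `LiDirichlet.riemannHypothesis_iff_tendsto_re_nonneg` — the same with the limit of the real parts
  of Li's partial sums.
* For a REAL primitive character (`χ⁻¹ = χ`): the boxes are conjugation stable, the partial sums are
  real (`conj_liPartialSum_of_real`), Li's limit EXISTS and `liCoeffChar χ n = liCoeffCharRe χ n`
  (`liCoeffChar_of_real`), and the criterion reads literally as printed,
  `χ.RiemannHypothesis ↔ ∀ n ≥ 1, 0 ≤ liCoeffChar χ n` (`riemannHypothesis_iff_liCoeffChar_nonneg_of_real`,
  `≤` of `ℂ` = `ComplexOrder`).
* `LiDirichlet.riemannHypothesis_iff_liCoeffCharRe_primitive_nonneg` — any non-principal `χ`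
  (imprimitive allowed), through the inducing primitive character `χ⋆`.

## References

* X.-J. Li, Illinois J. Math. 48 (2004) 491–503: Thm. 2 (p. 493), definition of `λ_χ(n)` (p. 494),
  p. 496 (the criterion spelled out for `ξ_E`). [Li2004]
* E. Bombieri, J. C. Lagarias, J. Number Theory 77 (1999) 274–287, Thm. 1. [BombieriLagarias1999]
* H. L. Montgomery, R. C. Vaughan, *Multiplicative Number Theory I*, Cor. 10.8, Thm. 10.17.
  [MontgomeryVaughan2007]
-/

noncomputable section

open Complex Filter Topology Set
open scoped ComplexConjugate ComplexOrder

namespace Literature.NumberTheory.LFunctions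

namespace LiDirichlet

open ExplicitPsiChar BombieriLagarias

variable {q : ℕ} [NeZero q]

/-- **Li's coefficient `λ_χ(n)` AS PRINTED** (Li 2004, p. 494): "`λ_χ(n) = Σ_ρ [1 − (1 − 1/ρ)ⁿ]`,
where the sum on `ρ` runs over all zeros of `ξ(s, χ)` in the order given by `|Im ρ| < T` for
`T → ∞`" — the symmetric limit of the partial sums over the non-trivial zeros of `L(s, χ)` counted
with multiplicity (`limUnder`: the junk value if the limit does not exist; existence is Li's
Theorem 4 and is not asserted here).  Truncation `|Im ρ| ≤ T` (the tree's `lfunctionZeroBox`)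
instead of `< T`: same limit. [cite: Li2004, p. 494 (definition of λ_χ(n))] -/
def liCoeffChar (χ : DirichletCharacter ℂ q) (n : ℕ) : ℂ :=
  limUnder atTop fun T : ℝ ↦
    ∑ᶠ ρ ∈ lfunctionZeroBox χ T, (DirichletDisc.zeroOrder χ ρ : ℂ) * (1 - (1 - 1 / ρ) ^ n)

/-- **The real part of Li's coefficient as an absolutely convergent sum**:
`Σ' ρ m_χ(ρ) · Re[1 − (1 − 1/ρ)ⁿ]` over the non-trivial zeros of `L(s, χ)` — Bombieri–Lagarias'
condition (2) quantity (their Theorem 1 prints the real part inside the sum), in Li's `+n`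
convention. [cite: Li2004, Theorem 2 (2) and p. 494] -/
def liCoeffCharRe (χ : DirichletCharacter ℂ q) (n : ℕ) : ℝ :=
  ∑' ρ : charNontrivialZeros χ,
    (DirichletDisc.zeroOrder χ (ρ : ℂ) : ℝ) * (1 - (1 - 1 / (ρ : ℂ)) ^ n).re

variable {χ : DirichletCharacter ℂ q}

/-- A non-trivial zero is `≠ 0`. [folklore] -/
private theorem ne_zero_of_mem {ρ : ℂ} (hρ : ρ ∈ charNontrivialZeros χ) : ρ ≠ 0 := by
  rintro rfl
  have h := hρ.2.1
  simp at h

/-- A non-trivial zero is `≠ 1`. [folklore] -/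
private theorem ne_one_of_mem {ρ : ℂ} (hρ : ρ ∈ charNontrivialZeros χ) : ρ ≠ 1 := by
  rintro rfl
  have h := hρ.2.2
  simp at h

/-- **Bombieri–Lagarias' hypothesis for the zeros of `ξ(s, χ)`** (`χ` primitive mod `q > 1`): the
reflected family `1 − ρ̄` has `m(ρ)(1 + |Re(1 − ρ̄)|)/(1 + |1 − ρ̄|)² ≤ 2 m(ρ)/(1 + γ²)`, summable by
`Σ m(ρ)/(1 + γ²) < ∞` (MV Thm. 10.17, `summable_zeroOrder_div_one_add_sq`); Li: "the conditions of
Bombieri–Lagarias' theorem are satisfied". [cite: Li2004, p. 494 and p. 496; MontgomeryVaughan2007, Theorem 10.17] -/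
theorem summable_weight_zeros (hprim : χ.IsPrimitive) (hq : 1 < q) :
    Summable (weight (fun ρ : charNontrivialZeros χ ↦ 1 - conj (ρ : ℂ))
      (fun ρ ↦ DirichletDisc.zeroOrder χ (ρ : ℂ))) := by
  refine Summable.of_nonneg_of_le (fun ρ ↦ weight_nonneg _ _ ρ) (fun ρ ↦ ?_)
    ((summable_zeroOrder_div_one_add_sq hprim hq).mul_left 2)
  obtain ⟨-, h0, h1⟩ := ρ.2
  have hm0 : (0 : ℝ) ≤ DirichletDisc.zeroOrder χ (ρ : ℂ) := Nat.cast_nonneg _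
  unfold weight
  have hre : |(1 - conj (ρ : ℂ)).re| ≤ 1 := by
    simp only [sub_re, one_re, Complex.conj_re]
    rw [abs_le]; constructor <;> linarith
  have him : |(ρ : ℂ).im| ≤ ‖1 - conj (ρ : ℂ)‖ := by
    have := Complex.abs_im_le_norm (1 - conj (ρ : ℂ))
    simpa [sub_im, one_im, Complex.conj_im] using this
  have hden : 1 + (ρ : ℂ).im ^ 2 ≤ (1 + ‖1 - conj (ρ : ℂ)‖) ^ 2 := by
    have h2 : |(ρ : ℂ).im| ^ 2 ≤ ‖1 - conj (ρ : ℂ)‖ ^ 2 := pow_le_pow_left₀ (abs_nonneg _) him 2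
    rw [sq_abs] at h2
    nlinarith [norm_nonneg (1 - conj (ρ : ℂ))]
  show (DirichletDisc.zeroOrder χ (ρ : ℂ) : ℝ) *
      ((1 + |(1 - conj (ρ : ℂ)).re|) / (1 + ‖1 - conj (ρ : ℂ)‖) ^ 2) ≤
    2 * ((DirichletDisc.zeroOrder χ (ρ : ℂ) : ℝ) / (1 + (ρ : ℂ).im ^ 2))
  calc (DirichletDisc.zeroOrder χ (ρ : ℂ) : ℝ) * ((1 + |(1 - conj (ρ : ℂ)).re|) / (1 + ‖1 - conj (ρ : ℂ)‖) ^ 2)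
      ≤ (DirichletDisc.zeroOrder χ (ρ : ℂ) : ℝ) * (2 / (1 + (ρ : ℂ).im ^ 2)) := by
        refine mul_le_mul_of_nonneg_left ?_ hm0
        rw [div_le_div_iff₀ (by positivity) (by positivity)]
        nlinarith [abs_nonneg ((1 - conj (ρ : ℂ)).re)]
    _ = 2 * ((DirichletDisc.zeroOrder χ (ρ : ℂ) : ℝ) / (1 + (ρ : ℂ).im ^ 2)) := by ring

/-- **Absolute convergence of the real parts**: `Σ_ρ m_χ(ρ) |Re[1 − (1 − 1/ρ)ⁿ]| < ∞` over the
non-trivial zeros of `L(s, χ)` (`χ` primitive mod `q > 1`). [cite: Li2004, Theorem 2 and p. 494] -/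
theorem summable_liTermRe (hprim : χ.IsPrimitive) (hq : 1 < q) (n : ℕ) :
    Summable fun ρ : charNontrivialZeros χ ↦
      (DirichletDisc.zeroOrder χ (ρ : ℂ) : ℝ) * (1 - (1 - 1 / (ρ : ℂ)) ^ n).re :=
  summable_term_pos (ρ := fun ρ : charNontrivialZeros χ ↦ (ρ : ℂ))
    (fun ρ ↦ one_le_zeroOrder_of_mem (ne_one_of_isPrimitive hprim hq) ρ.2)
    (fun ρ ↦ ne_zero_of_mem ρ.2) (fun ρ ↦ ne_one_of_mem ρ.2) (summable_weight_zeros hprim hq) n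

/-- **The real parts of Li's partial sums converge** (unconditionally) to `liCoeffCharRe χ n`:
`Re Σ_{|Im ρ| ≤ T} m(ρ)[1 − (1 − 1/ρ)ⁿ] → Σ' ρ m(ρ) Re[1 − (1 − 1/ρ)ⁿ]` as `T → ∞` — the truncations
exhaust the zeros (`tendsto_charZeroFinset`) and the real family is absolutely summable.
[cite: Li2004, p. 494 (the order |Im ρ| < T)] -/
theorem tendsto_re_liPartialSum (hprim : χ.IsPrimitive) (hq : 1 < q) (n : ℕ) :
    Tendsto (fun T : ℝ ↦ (∑ᶠ ρ ∈ lfunctionZeroBox χ T,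
        (DirichletDisc.zeroOrder χ ρ : ℂ) * (1 - (1 - 1 / ρ) ^ n)).re)
      atTop (𝓝 (liCoeffCharRe χ n)) := by
  classical
  have hχ : χ ≠ 1 := ne_one_of_isPrimitive hprim hq
  set f : charNontrivialZeros χ → ℝ := fun ρ ↦
    (DirichletDisc.zeroOrder χ (ρ : ℂ) : ℝ) * (1 - (1 - 1 / (ρ : ℂ)) ^ n).re with hf
  have hsum : HasSum f (liCoeffCharRe χ n) := (summable_liTermRe hprim hq n).hasSum
  have hlim := hsum.comp (tendsto_charZeroFinset hχ)
  refine hlim.congr fun T ↦ ?_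
  simp only [Function.comp_apply]
  rw [finsum_mem_eq_finite_toFinset_sum _ (lfunctionZeroBox_finite hχ T), Complex.re_sum,
    ← sum_charZeroFinset_eq hχ T (fun ρ : ℂ ↦ ((DirichletDisc.zeroOrder χ ρ : ℂ) * (1 - (1 - 1 / ρ) ^ n)).re)]
  refine Finset.sum_congr rfl fun ρ _ ↦ ?_
  simp only [hf, Complex.mul_re, Complex.natCast_re, Complex.natCast_im, zero_mul, sub_zero]

/-- If Li's symmetric limit `λ_χ(n)` exists (his Theorem 4), its real part is `liCoeffCharRe χ n`
and `liCoeffChar χ n` is that limit. [cite: Li2004, p. 494] -/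
theorem re_eq_liCoeffCharRe_of_tendsto (hprim : χ.IsPrimitive) (hq : 1 < q) {n : ℕ} {L : ℂ}
    (hL : Tendsto (fun T : ℝ ↦ ∑ᶠ ρ ∈ lfunctionZeroBox χ T,
        (DirichletDisc.zeroOrder χ ρ : ℂ) * (1 - (1 - 1 / ρ) ^ n)) atTop (𝓝 L)) :
    liCoeffChar χ n = L ∧ L.re = liCoeffCharRe χ n := by
  refine ⟨hL.limUnder_eq, ?_⟩
  exact tendsto_nhds_unique ((Complex.continuous_re.tendsto L).comp hL)
    (tendsto_re_liPartialSum hprim hq n)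

/-- **Li's criterion for `L(s, χ)`** (Li 2004, p. 494 with Theorem 2 = Bombieri–Lagarias 1999,
Theorem 1): for a primitive Dirichlet character `χ` modulo `q > 1`, the Riemann hypothesis for
`L(s, χ)` holds if and only if `Re λ_χ(n) ≥ 0` for every `n ≥ 1`, where
`Re λ_χ(n) = Σ_ρ m_χ(ρ) Re[1 − (1 − 1/ρ)ⁿ]` over the non-trivial zeros (absolutely convergent;
`= Re` of Li's symmetric limit whenever it exists, `re_eq_liCoeffCharRe_of_tendsto`).  Proof:
`bombieriLagarias1999_theorem1_pos` for the family of non-trivial zeros with their multiplicities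
gives `Re ρ ≥ 1/2` for all of them; the symmetry `ρ ↦ 1 − ρ̄` of the zeros of `ξ(s, χ)`
(`WeilConverseChar.one_sub_conj_mem`, MV Cor. 10.8) upgrades this to `Re ρ = 1/2`.
[cite: Li2004, p. 494 and Theorem 2; BombieriLagarias1999, Theorem 1] -/
theorem riemannHypothesis_iff_liCoeffCharRe_nonneg (hprim : χ.IsPrimitive) (hq : 1 < q) :
    χ.RiemannHypothesis ↔ ∀ n : ℕ, 1 ≤ n → 0 ≤ liCoeffCharRe χ n := by
  have hχ : χ ≠ 1 := ne_one_of_isPrimitive hprim hq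
  have hBL := bombieriLagarias1999_theorem1_pos (fun ρ : charNontrivialZeros χ ↦ (ρ : ℂ))
    (fun ρ ↦ DirichletDisc.zeroOrder χ (ρ : ℂ))
    (fun ρ ↦ one_le_zeroOrder_of_mem hχ ρ.2)
    (fun ρ ↦ ne_zero_of_mem ρ.2) (fun ρ ↦ ne_one_of_mem ρ.2) (summable_weight_zeros hprim hq)
  change _ ↔ ∀ n : ℕ, 1 ≤ n → 0 ≤ ∑' ρ : charNontrivialZeros χ,
    (DirichletDisc.zeroOrder χ (ρ : ℂ) : ℝ) * (1 - (1 - 1 / (ρ : ℂ)) ^ n).re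
  rw [← hBL]
  constructor
  · intro hRH ρ
    obtain ⟨hz, h0, h1⟩ := ρ.2
    rw [hRH ρ hz h0 h1]
  · intro h s hs h0 h1
    have hρ : s ∈ charNontrivialZeros χ := ⟨hs, h0, h1⟩
    have hge : 1 / 2 ≤ s.re := h ⟨s, hρ⟩
    have hle := h ⟨1 - conj s, WeilConverseChar.one_sub_conj_mem hprim hχ hρ⟩
    simp only [sub_re, one_re, Complex.conj_re] at hle
    linarith

/-- The criterion in Li's own wording modulo the real part: GRH for `L(s, χ)` iff for every `n ≥ 1`
the real parts of Li's partial sums `Σ_{|Im ρ| ≤ T} m(ρ)[1 − (1 − 1/ρ)ⁿ]` have a non-negative limit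
as `T → ∞`. [cite: Li2004, p. 494 and Theorem 2] -/
theorem riemannHypothesis_iff_tendsto_re_nonneg (hprim : χ.IsPrimitive) (hq : 1 < q) :
    χ.RiemannHypothesis ↔ ∀ n : ℕ, 1 ≤ n → ∃ L : ℝ, 0 ≤ L ∧
      Tendsto (fun T : ℝ ↦ (∑ᶠ ρ ∈ lfunctionZeroBox χ T,
        (DirichletDisc.zeroOrder χ ρ : ℂ) * (1 - (1 - 1 / ρ) ^ n)).re) atTop (𝓝 L) := by
  rw [riemannHypothesis_iff_liCoeffCharRe_nonneg hprim hq]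
  refine forall_congr' fun n ↦ forall_congr' fun _ ↦ ⟨fun h ↦ ⟨_, h, tendsto_re_liPartialSum hprim hq n⟩, ?_⟩
  rintro ⟨L, hL0, hL⟩
  rwa [tendsto_nhds_unique (tendsto_re_liPartialSum hprim hq n) hL]

/-! ### Real characters: `λ_χ(n)` is real and Li's limit exists -/

/-- For a REAL character (`χ̄ = χ`, i.e. `χ⁻¹ = χ`) the boxes of non-trivial zeros are conjugation
stable with `m(ρ̄) = m(ρ)` (`L(s̄, χ) = conj L(s, χ̄)`, MV Cor. 10.8).
[cite: MontgomeryVaughan2007, Corollary 10.8] -/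
theorem conj_mem_lfunctionZeroBox_of_real (hχ : χ ≠ 1) (hreal : χ⁻¹ = χ) {T : ℝ} {ρ : ℂ}
    (hρ : ρ ∈ lfunctionZeroBox χ T) : conj ρ ∈ lfunctionZeroBox χ T := by
  obtain ⟨hz, h0, h1, hT⟩ := hρ
  refine ⟨?_, by simpa using h0, by simpa using h1, by simpa using hT⟩
  have hm : 0 < DirichletDisc.zeroOrder χ (conj ρ) := by
    rw [← congrArg (fun ψ ↦ DirichletDisc.zeroOrder ψ (conj ρ)) hreal,
      WeilConverseChar.zeroOrder_inv_conj hχ ρ]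
    exact (DirichletDisc.zeroOrder_pos_iff χ hχ ρ).2 hz
  exact (DirichletDisc.zeroOrder_pos_iff χ hχ _).1 hm

/-- For a real character Li's partial sums `Σ_{|Im ρ| ≤ T} m(ρ)[1 − (1 − 1/ρ)ⁿ]` are real (they are
fixed by conjugation, which permutes the box and preserves multiplicities).
[cite: Li2004, p. 494; MontgomeryVaughan2007, Corollary 10.8] -/
theorem conj_liPartialSum_of_real (hχ : χ ≠ 1) (hreal : χ⁻¹ = χ) (n : ℕ) (T : ℝ) :
    conj (∑ᶠ ρ ∈ lfunctionZeroBox χ T, (DirichletDisc.zeroOrder χ ρ : ℂ) * (1 - (1 - 1 / ρ) ^ n)) =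
      ∑ᶠ ρ ∈ lfunctionZeroBox χ T, (DirichletDisc.zeroOrder χ ρ : ℂ) * (1 - (1 - 1 / ρ) ^ n) := by
  classical
  rw [finsum_mem_eq_finite_toFinset_sum _ (lfunctionZeroBox_finite hχ T), map_sum]
  have hm : ∀ ρ : ℂ, DirichletDisc.zeroOrder χ (conj ρ) = DirichletDisc.zeroOrder χ ρ := by
    intro ρ
    rw [← congrArg (fun ψ ↦ DirichletDisc.zeroOrder ψ (conj ρ)) hreal,
      WeilConverseChar.zeroOrder_inv_conj hχ ρ]
  have hterm : ∀ ρ : ℂ, conj ((DirichletDisc.zeroOrder χ ρ : ℂ) * (1 - (1 - 1 / ρ) ^ n)) =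
      (DirichletDisc.zeroOrder χ (conj ρ) : ℂ) * (1 - (1 - 1 / conj ρ) ^ n) := by
    intro ρ
    rw [hm, map_mul, map_natCast, map_sub, map_one, map_pow, map_sub, map_one, map_div₀, map_one]
  simp_rw [hterm]
  set B := (lfunctionZeroBox_finite hχ T).toFinset with hB
  have hmem : ∀ ρ, ρ ∈ B ↔ ρ ∈ lfunctionZeroBox χ T := fun ρ ↦ Set.Finite.mem_toFinset _
  exact Finset.sum_nbij' (fun ρ ↦ conj ρ) (fun ρ ↦ conj ρ)
    (fun ρ hρ ↦ (hmem _).2 (conj_mem_lfunctionZeroBox_of_real hχ hreal ((hmem ρ).1 hρ)))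
    (fun ρ hρ ↦ (hmem _).2 (conj_mem_lfunctionZeroBox_of_real hχ hreal ((hmem ρ).1 hρ)))
    (fun ρ _ ↦ Complex.conj_conj ρ) (fun ρ _ ↦ Complex.conj_conj ρ) fun ρ _ ↦ rfl

/-- **For a real primitive character Li's `λ_χ(n)` exists as printed and is real**: the partial
sums (real by `conj_liPartialSum_of_real`) converge to `liCoeffCharRe χ n`.
[cite: Li2004, p. 494] -/
theorem tendsto_liPartialSum_of_real (hprim : χ.IsPrimitive) (hq : 1 < q) (hreal : χ⁻¹ = χ)
    (n : ℕ) :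
    Tendsto (fun T : ℝ ↦ ∑ᶠ ρ ∈ lfunctionZeroBox χ T,
        (DirichletDisc.zeroOrder χ ρ : ℂ) * (1 - (1 - 1 / ρ) ^ n))
      atTop (𝓝 ((liCoeffCharRe χ n : ℝ) : ℂ)) := by
  have hχ : χ ≠ 1 := ne_one_of_isPrimitive hprim hq
  have h := (Complex.continuous_ofReal.tendsto _).comp (tendsto_re_liPartialSum hprim hq n)
  refine h.congr fun T ↦ ?_
  simp only [Function.comp_apply]
  exact Complex.conj_eq_iff_re.1 (conj_liPartialSum_of_real hχ hreal n T)

/-- For a real primitive character: `λ_χ(n) = liCoeffCharRe χ n` (Li's symmetric limit exists and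
is the absolutely convergent real sum). [cite: Li2004, p. 494] -/
theorem liCoeffChar_of_real (hprim : χ.IsPrimitive) (hq : 1 < q) (hreal : χ⁻¹ = χ) (n : ℕ) :
    liCoeffChar χ n = liCoeffCharRe χ n :=
  (tendsto_liPartialSum_of_real hprim hq hreal n).limUnder_eq

/-- **Li's criterion for a REAL primitive character, literally as printed**: GRH for `L(s, χ)` iff
`λ_χ(n) ≥ 0` for all `n ≥ 1` (`λ_χ(n)` real, `liCoeffChar_of_real`; `≥ 0` in `ℂ` = real and
non-negative). [cite: Li2004, p. 494 and Theorem 2; BombieriLagarias1999, Theorem 1] -/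
theorem riemannHypothesis_iff_liCoeffChar_nonneg_of_real (hprim : χ.IsPrimitive) (hq : 1 < q)
    (hreal : χ⁻¹ = χ) :
    χ.RiemannHypothesis ↔ ∀ n : ℕ, 1 ≤ n → (0 : ℂ) ≤ liCoeffChar χ n := by
  rw [riemannHypothesis_iff_liCoeffCharRe_nonneg hprim hq]
  refine forall_congr' fun n ↦ forall_congr' fun _ ↦ ?_
  rw [liCoeffChar_of_real hprim hq hreal n]
  exact Complex.zero_le_real.symm

/-! ### Imprimitive characters -/

/-- **Any non-principal character** `χ` mod `q` (imprimitive allowed): GRH for `L(s, χ)` iff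
`Re λ_{χ⋆}(n) ≥ 0` for all `n ≥ 1`, `χ⋆` the primitive character inducing `χ` — the non-trivial
zeros of `L(s, χ)` and `L(s, χ⋆)` coincide (`L(s, χ) = L(s, χ⋆) ∏_{p ∣ q}(1 − χ⋆(p)p^{−s})`, the Euler
factors vanishing only on `Re s = 0`; `DirichletCharacter.riemannHypothesis_iff_primitiveCharacter_holds`),
and Li's setting is the primitive `χ⋆` of modulus `r > 1`.
[cite: Li2004, p. 493–494; MontgomeryVaughan2007, §10.1 (10.20)] -/
theorem riemannHypothesis_iff_liCoeffCharRe_primitive_nonneg (hχ : χ ≠ 1) :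
    χ.RiemannHypothesis ↔
      haveI : NeZero χ.conductor := ⟨χ.conductor_ne_zero⟩
      ∀ n : ℕ, 1 ≤ n → 0 ≤ liCoeffCharRe χ.primitiveCharacter n := by
  haveI : NeZero χ.conductor := ⟨χ.conductor_ne_zero⟩
  have h1 : χ.conductor ≠ 1 := fun h ↦ hχ (DirichletCharacter.eq_one_iff_conductor_eq_one.2 h)
  have h0 : χ.conductor ≠ 0 := χ.conductor_ne_zero
  have hc1 : 1 < χ.conductor := by omega
  rw [DirichletCharacter.riemannHypothesis_iff_primitiveCharacter_holds χ]
  exact riemannHypothesis_iff_liCoeffCharRe_nonneg χ.primitiveCharacter_isPrimitive hc1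

end LiDirichlet

end Literature.NumberTheory.LFunctions
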